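import Mathlib.Algebra.Group.Subgroup.Lattice
import Mathlib.Algebra.Group.Subgroup.Ker
import Mathlib.Tactic.Group
import HarnessLib

/-!
# Gluing homomorphisms on `H₁ ⊔ H₂`; factoring a homomorphism through the range

Topic `Literature/GroupTheory`; namespace `Literature.GroupTheory` (sub-namespaces `MonoidHom`,
`Subgroup`). Theorem-only file (no named fact, no new notion, no instance):

* `MonoidHom.exists_range_factor` — a homomorphism `φ : G →* M` (`M` commutative) killing `ker f`
  factors through `f.range`: `∃ χ : f.range →* M, χ (f x) = φ x`;
* `Subgroup.glue_wd`, **`Subgroup.exists_monoidHom_sup_extends`**, `Subgroup.monoidHom_sup_ext` — in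
  a commutative group `G`, homomorphisms `χ₁ : H₁ →* M`, `χ₂ : H₂ →* M` into a commutative group
  which AGREE on `H₁ ⊓ H₂` glue to a unique homomorphism of `H₁ ⊔ H₂` extending both
  (`x = y z ↦ χ₁ y · χ₂ z` is well defined).

Elementary (the Mayer–Vietoris exactness
`Hom(H₁ ⊔ H₂, M) → Hom(H₁, M) × Hom(H₂, M) ⇉ Hom(H₁ ⊓ H₂, M)` for abelian groups); used to glue a
character prescribed on two subgroups of an idele class group (an ∞-type on `K_∞ˣ` and a character
on a second subgroup, compatible on the intersection).

## Provenance

Reproduced for the tree under the LEAN-IN-TREE rule (2026-08-18) from the pub-hodgecm cell's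
package file `HodgeCM/PerL34/CharacterGluing.lean` §§1–2 (DAG-node prover #10 lineage, seat pv10,
gate run 21), verbatim up to the namespace and added docstring tags; its §3 (the idele-class
instance) lands with `Literature/NumberTheory/Automorphic/UnitaryInfinityType.lean`.
-/

set_option autoImplicit false

namespace Literature.GroupTheory

/-! ## Factoring through the range -/

namespace MonoidHom

variable {G H M : Type*} [Group G] [Group H] [CommGroup M]

/-- A homomorphism into a commutative group that kills `ker f` factors through `f.range`.
[folklore] -/
theorem exists_range_factor (f : G →* H) (φ : G →* M) (hker : ∀ x, f x = 1 → φ x = 1) :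
    ∃ χ : f.range →* M, ∀ x : G, χ ⟨f x, ⟨x, rfl⟩⟩ = φ x := by
  classical
  -- well-definedness
  have wd : ∀ a b : G, f a = f b → φ a = φ b := by
    intro a b hab
    have h1 : f (a * b⁻¹) = 1 := by rw [map_mul, map_inv, hab, mul_inv_cancel]
    have h2 := hker _ h1
    rw [map_mul, map_inv, mul_inv_eq_one] at h2
    exact h2
  let pre : f.range → G := fun r => r.2.choose
  have hpre : ∀ r : f.range, f (pre r) = r := fun r => r.2.choose_spec
  refine ⟨{ toFun := fun r => φ (pre r), map_one' := ?_, map_mul' := ?_ }, ?_⟩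
  · have : f (pre 1) = f 1 := by rw [hpre, map_one]; rfl
    rw [wd _ _ this, map_one]
  · intro a b
    have : f (pre (a * b)) = f (pre a * pre b) := by
      rw [map_mul, hpre, hpre, hpre]; rfl
    show φ (pre (a * b)) = φ (pre a) * φ (pre b)
    rw [wd _ _ this, map_mul]
  · intro x
    show φ (pre ⟨f x, ⟨x, rfl⟩⟩) = φ x
    exact wd _ _ (hpre ⟨f x, ⟨x, rfl⟩⟩)

end MonoidHom

/-! ## Gluing on `H₁ ⊔ H₂` -/

namespace Subgroup

variable {G M : Type*} [CommGroup G] [CommGroup M] {H₁ H₂ : Subgroup G}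

/-- Well-definedness of the glued value `χ₁ y · χ₂ z` for `x = y z`. [folklore] -/
theorem glue_wd (χ₁ : H₁ →* M) (χ₂ : H₂ →* M)
    (h : ∀ (x : G) (h1 : x ∈ H₁) (h2 : x ∈ H₂), χ₁ ⟨x, h1⟩ = χ₂ ⟨x, h2⟩)
    {y y' z z' : G} (hy : y ∈ H₁) (hy' : y' ∈ H₁) (hz : z ∈ H₂) (hz' : z' ∈ H₂)
    (heq : y * z = y' * z') :
    χ₁ ⟨y, hy⟩ * χ₂ ⟨z, hz⟩ = χ₁ ⟨y', hy'⟩ * χ₂ ⟨z', hz'⟩ := by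
  have key : y'⁻¹ * y = z' * z⁻¹ := by
    have e1 : y'⁻¹ * y = y'⁻¹ * (y * z) * z⁻¹ := by group
    rw [e1, heq]; group
  have ht1 : y'⁻¹ * y ∈ H₁ := mul_mem (inv_mem hy') hy
  have ht2 : y'⁻¹ * y ∈ H₂ := key ▸ mul_mem hz' (inv_mem hz)
  have hχ := h _ ht1 ht2
  have e2 : (⟨y'⁻¹ * y, ht1⟩ : H₁) = ⟨y', hy'⟩⁻¹ * ⟨y, hy⟩ := rfl
  have e3 : (⟨y'⁻¹ * y, ht2⟩ : H₂) = ⟨z', hz'⟩ * ⟨z, hz⟩⁻¹ := Subtype.ext key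
  rw [e2, e3, map_mul, map_inv, map_mul, map_inv] at hχ
  calc χ₁ ⟨y, hy⟩ * χ₂ ⟨z, hz⟩
      = χ₁ ⟨y', hy'⟩ * ((χ₁ ⟨y', hy'⟩)⁻¹ * χ₁ ⟨y, hy⟩) * χ₂ ⟨z, hz⟩ := by group
    _ = χ₁ ⟨y', hy'⟩ * (χ₂ ⟨z', hz'⟩ * (χ₂ ⟨z, hz⟩)⁻¹) * χ₂ ⟨z, hz⟩ := by rw [hχ]
    _ = χ₁ ⟨y', hy'⟩ * χ₂ ⟨z', hz'⟩ := by group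

/-- **Gluing.**  Characters of `H₁` and `H₂` that agree on `H₁ ⊓ H₂` extend to a character of
`H₁ ⊔ H₂`. [folklore] -/
theorem exists_monoidHom_sup_extends (χ₁ : H₁ →* M) (χ₂ : H₂ →* M)
    (h : ∀ (x : G) (h1 : x ∈ H₁) (h2 : x ∈ H₂), χ₁ ⟨x, h1⟩ = χ₂ ⟨x, h2⟩) :
    ∃ χ : (H₁ ⊔ H₂ : Subgroup G) →* M,
      (∀ (x : G) (hx : x ∈ H₁), χ ⟨x, Subgroup.mem_sup_left hx⟩ = χ₁ ⟨x, hx⟩) ∧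
      (∀ (x : G) (hx : x ∈ H₂), χ ⟨x, Subgroup.mem_sup_right hx⟩ = χ₂ ⟨x, hx⟩) := by
  classical
  let Y : (H₁ ⊔ H₂ : Subgroup G) → G := fun x => (Subgroup.mem_sup.mp x.2).choose
  have hY : ∀ x, Y x ∈ H₁ := fun x => (Subgroup.mem_sup.mp x.2).choose_spec.1
  let Z : (H₁ ⊔ H₂ : Subgroup G) → G := fun x => (Subgroup.mem_sup.mp x.2).choose_spec.2.choose
  have hZ : ∀ x, Z x ∈ H₂ := fun x => (Subgroup.mem_sup.mp x.2).choose_spec.2.choose_spec.1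
  have hYZ : ∀ x, Y x * Z x = x := fun x => (Subgroup.mem_sup.mp x.2).choose_spec.2.choose_spec.2
  refine ⟨{ toFun := fun x => χ₁ ⟨Y x, hY x⟩ * χ₂ ⟨Z x, hZ x⟩, map_one' := ?_, map_mul' := ?_ },
    ?_, ?_⟩
  · have e := glue_wd χ₁ χ₂ h (hY 1) H₁.one_mem (hZ 1) H₂.one_mem (by rw [hYZ, one_mul]; rfl)
    rw [e]
    show χ₁ 1 * χ₂ 1 = 1
    rw [map_one, map_one, one_mul]
  · intro a b
    have e := glue_wd χ₁ χ₂ h (hY (a * b)) (mul_mem (hY a) (hY b)) (hZ (a * b))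
      (mul_mem (hZ a) (hZ b)) (by
        rw [hYZ, mul_mul_mul_comm, hYZ, hYZ]; rfl)
    show χ₁ ⟨Y (a * b), _⟩ * χ₂ ⟨Z (a * b), _⟩ =
      χ₁ ⟨Y a, hY a⟩ * χ₂ ⟨Z a, hZ a⟩ * (χ₁ ⟨Y b, hY b⟩ * χ₂ ⟨Z b, hZ b⟩)
    rw [e]
    have e1 : (⟨Y a * Y b, mul_mem (hY a) (hY b)⟩ : H₁) = ⟨Y a, hY a⟩ * ⟨Y b, hY b⟩ := rfl
    have e2 : (⟨Z a * Z b, mul_mem (hZ a) (hZ b)⟩ : H₂) = ⟨Z a, hZ a⟩ * ⟨Z b, hZ b⟩ := rfl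
    rw [e1, e2, map_mul, map_mul, mul_mul_mul_comm]
  · intro x hx
    show χ₁ ⟨Y _, hY _⟩ * χ₂ ⟨Z _, hZ _⟩ = χ₁ ⟨x, hx⟩
    rw [glue_wd χ₁ χ₂ h (hY _) hx (hZ _) H₂.one_mem (by rw [hYZ, mul_one])]
    show χ₁ ⟨x, hx⟩ * χ₂ 1 = χ₁ ⟨x, hx⟩
    rw [map_one, mul_one]
  · intro x hx
    show χ₁ ⟨Y _, hY _⟩ * χ₂ ⟨Z _, hZ _⟩ = χ₂ ⟨x, hx⟩
    rw [glue_wd χ₁ χ₂ h (hY _) H₁.one_mem (hZ _) hx (by rw [hYZ, one_mul])]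
    show χ₁ 1 * χ₂ ⟨x, hx⟩ = χ₂ ⟨x, hx⟩
    rw [map_one, one_mul]

/-- Uniqueness of the glued homomorphism on `H₁ ⊔ H₂`. [folklore] -/
theorem monoidHom_sup_ext {χ χ' : (H₁ ⊔ H₂ : Subgroup G) →* M}
    (h1 : ∀ (x : G) (hx : x ∈ H₁),
      χ ⟨x, Subgroup.mem_sup_left hx⟩ = χ' ⟨x, Subgroup.mem_sup_left hx⟩)
    (h2 : ∀ (x : G) (hx : x ∈ H₂),
      χ ⟨x, Subgroup.mem_sup_right hx⟩ = χ' ⟨x, Subgroup.mem_sup_right hx⟩) :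
    χ = χ' := by
  ext ⟨x, hx⟩
  obtain ⟨y, hy, z, hz, rfl⟩ := Subgroup.mem_sup.mp hx
  have : (⟨y * z, hx⟩ : (H₁ ⊔ H₂ : Subgroup G)) =
      ⟨y, Subgroup.mem_sup_left hy⟩ * ⟨z, Subgroup.mem_sup_right hz⟩ :=
    rfl
  rw [this, map_mul, map_mul, h1 y hy, h2 z hz]

end Subgroup

end Literature.GroupTheory
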